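import Mathlib
import HarnessLib
import Summits.HubbardSuperconductivity.HubbardSuperconductivity.Theorems.KLProgrammeC4aMonotoneBoxRows
import Summits.HubbardSuperconductivity.HubbardSuperconductivity.Theorems.KLProgrammeC4aCausticWindowTiling

/-!
# Route `KLProgramme` — crux C4a, S3 brick (B4) «(U1)-ZONE-ASSEMBLY» part 1: the box integral `F(ϑ) = |∫_{−hi}^{hi}∫_{φa}^{φb} w·X·(K e)′(ē)|` is CONTINUOUS in the
# relative angle `ϑ`, hence interval-integrable on every `ϑ`-tile — the one integrability row the tiling sum `…C4aCausticWindowTiling` asks, DISCHARGED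

Cell `gate-hubbard-kl`, seat hubbard-kl-k3c3-p3 (g34; row «implicit-function / monotonicity route for μ(n)»).  Located brick for the (C)-closer lane / the (M4)
assembly of the umklapp first-order ϑ-layer (stub (C) `stub_twoLeg_curvature` of `KLRegimeEngineV17F2`, stmt-HubbardSuperconductivity-20437), memo
HOME/hubbard-kl-k3c3-p3/U1-CAUSTIC-SUP.md §16.

WHY.  The per-box theorems of the chain (`…C4aNearCausticBoxPrimed.nearCausticBox_integral_le'`, `…C4aNoWitnessBox.noWitnessBox_integral_le`) bound
`∫_{α..β} F(ϑ) dϑ` on one `ϑ`-tile; the zone assembly sums the tiles with `…C4aCausticWindowTiling.intervalIntegral_le_card_mul_of_tiling_of_integrable`, which asks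
`IntervalIntegrable F volume a (a + Nω)`.  Here that row is discharged from rows the box theorems already carry: `X` jointly continuous on `[−hi,hi] × ℝ`, `∂ᵤK`
jointly continuous, `w` continuous on `[−hi,hi]`, `|ρ| < r`, `0 ≤ hi < r`.  Device: the integrand is made continuous in ALL of `(ϑ, e, v)` by clamping the loop level `e`
to `[−hi,hi]` (`max (−hi) (min e hi)`, the identity on the integration range, so the integral is unchanged), then
`Literature.Analysis.FluidPDE.continuousOn_parametric_intervalIntegral` twice (loop angle, then loop level).  Lean note: every composition with `levelPoint` /
`deriv (K ·)` is elaborated WITHOUT an expected type (explicit `(f := …)`, result in `∘`-form) and converted by `Continuous.congr … fun _ => rfl` — unifying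
`F ∘ ?f` against a lambda headed by `levelPoint` unfolds the chart and times out (memo §13 lesson).
* `continuous_clampedBoxIntegral`, `intervalIntegral_comp_clamp` (generic: a jointly continuous integrand gives a continuous iterated interval integral; the clamp is
  invisible on the range).
* `continuous_pairSumPath_angle` (`ϑ ↦ S(ϑ) = Φ(0,θ) + Φ(ρ,ϑ+θ)` is continuous for `|ρ| < r`).
* **`continuous_boxIntegral`** (the signed box integral is continuous in `ϑ`), **`continuous_boxAbsIntegral`**, **`boxAbsIntegral_intervalIntegrable`**.
* **`boxAbsIntegral_le_card_mul_of_tiling`**: per-tile bounds `∫_{a+kω}^{a+(k+1)ω} F ≤ b` (`k < N`, `0 ≤ ω`) ⟹ `∫_a^{a+Nω} F ≤ N·b` — NO integrability hypothesis left.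
Sizes binder shape; pure plumbing; nothing asserts (C), K3 or superconductivity.
References: FST II CPAM 51 (1998) §3 [cite: FeldmanSalmhoferTrubowitz1998]; Evans, PDE, App. C (continuity of parametric integrals) [folklore].
-/

noncomputable section

namespace Summit.HubbardSuperconductivity.HubbardSuperconductivity.Theorems.C4a

set_option linter.dupNamespace false -- summit = problem name (single-conjunct summit), D-0017

open Real Set MeasureTheory intervalIntegral
open scoped Interval
open Literature.MathematicalPhysics.QuantumLattice Literature.MathematicalPhysics.QuantumLattice.BandSectorCounting
open Literature.MathematicalPhysics.QuantumLattice.FermiRG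
open Summit.HubbardSuperconductivity.HubbardSuperconductivity.Theorems.KLRegimeSplit
open Summit.HubbardSuperconductivity.HubbardSuperconductivity.Theorems.DispersionFlow
open Summit.HubbardSuperconductivity.HubbardSuperconductivity.Theorems.PerturbedFermiCurve

/-! ## §1 Generic: iterated interval integrals of jointly continuous integrands; the clamp -/

/-- **A jointly continuous integrand has a continuous iterated interval integral**: `G` continuous on `ℝ × (ℝ × ℝ)` ⟹
`ϑ ↦ ∫_{a..b} ∫_{φa..φb} G(ϑ,(e,v)) dv de` is continuous (`Literature…continuousOn_parametric_intervalIntegral` twice). [folklore] -/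
theorem continuous_clampedBoxIntegral {G : ℝ × (ℝ × ℝ) → ℝ} (hG : Continuous G) (a b φa φb : ℝ) :
    Continuous fun ϑ : ℝ => ∫ e in a..b, ∫ v in φa..φb, G (ϑ, (e, v)) := by
  -- loop angle first: parameters `(ϑ, e)`, variable `v`
  have hH₁ : Continuous fun q : ℝ × (ℝ × ℝ) => G (q.2.1, (q.2.2, q.1)) :=
    hG.comp ((continuous_fst.comp continuous_snd).prodMk ((continuous_snd.comp continuous_snd).prodMk continuous_fst))
  have h1 : ContinuousOn (fun p : ℝ × ℝ => ∫ v in φa..φb, (fun q : ℝ × (ℝ × ℝ) => G (q.2.1, (q.2.2, q.1))) (v, p)) univ :=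
    Literature.Analysis.FluidPDE.continuousOn_parametric_intervalIntegral (D := (univ : Set (ℝ × ℝ))) (hH₁.continuousOn.mono (subset_univ _)) φa φb
  have h1c : Continuous fun p : ℝ × ℝ => ∫ v in φa..φb, G (p.1, (p.2, v)) := by
    have := continuousOn_univ.1 h1
    exact this
  -- then the loop level: parameter `ϑ`, variable `e`
  have hH₂ : Continuous fun q : ℝ × ℝ => ∫ v in φa..φb, G (q.2, (q.1, v)) := h1c.comp (continuous_snd.prodMk continuous_fst)
  have h2 : ContinuousOn (fun ϑ : ℝ => ∫ e in a..b, (fun q : ℝ × ℝ => ∫ v in φa..φb, G (q.2, (q.1, v))) (e, ϑ)) univ :=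
    Literature.Analysis.FluidPDE.continuousOn_parametric_intervalIntegral (D := (univ : Set ℝ)) (hH₂.continuousOn.mono (subset_univ _)) a b
  have h2c := continuousOn_univ.1 h2
  exact h2c

/-- **The clamp `e ↦ max a (min e b)` is invisible on the integration range**: `a ≤ b` ⟹ `∫_{a..b} f(max a (min e b)) de = ∫_{a..b} f(e) de`. [folklore] -/
theorem intervalIntegral_comp_clamp {E : Type*} [NormedAddCommGroup E] [NormedSpace ℝ E] {f : ℝ → E} {a b : ℝ} (hab : a ≤ b) :
    ∫ e in a..b, f (max a (min e b)) = ∫ e in a..b, f e := by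
  refine intervalIntegral.integral_congr fun e he => ?_
  rw [uIcc_of_le hab] at he
  simp only [min_eq_left he.2, max_eq_right he.1]

/-! ## §2 The box integral of the chain -/

section Sizes

variable {K : TrigPolyC4v} {A : ℝ} (hA : ∀ p : Momentum, ∀ j ≤ 2, ‖iteratedFDeriv ℝ j (frameShift K) p‖ ≤ A)
  (hd : klCurveD ≤ (bandBounds (show (-4 : ℝ) < -1.1 by norm_num) (show (-1.1 : ℝ) ≤ -0.1 by norm_num)
    (show (-0.1 : ℝ) < 0 by norm_num)).Dtmin - 2 * A)
  {μ r : ℝ} (hlo : (-1.1 : ℝ) < μ - r - A) (hhi : μ + r + A < -0.1)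
include hA hd hlo hhi

/-- **The pair-sum path is continuous in the relative angle**: `ϑ ↦ S(ϑ) = Φ(0,θ) + Φ(ρ,ϑ+θ)` (`pairSumPath μ K ρ ϑ θ 0`) is continuous for `|ρ| < r`. -/
theorem continuous_pairSumPath_angle {ρ : ℝ} (hρ : |ρ| < r) (θ : ℝ) : Continuous fun ϑ : ℝ => pairSumPath μ K ρ ϑ θ 0 := by
  set B := bandBounds (show (-4 : ℝ) < -1.1 by norm_num) (show (-1.1 : ℝ) ≤ -0.1 by norm_num) (show (-0.1 : ℝ) < 0 by norm_num) with hBdef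
  have hADt : 2 * A < B.Dtmin := by have := klCurveD_pos; linarith only [this, hd]
  have hlev : ContinuousOn (fun p : ℝ × ℝ => levelPoint μ K p.1 p.2) ({x : ℝ | |x| < r} ×ˢ univ) :=
    (contDiffOn_levelPoint B hA hADt hlo hhi (m := 0)).continuousOn
  have hf : Continuous fun ϑ : ℝ => ((ρ, ϑ + θ + 0) : ℝ × ℝ) := continuous_const.prodMk ((continuous_id.add continuous_const).add continuous_const)
  have h2 := hlev.comp_continuous (f := fun ϑ : ℝ => ((ρ, ϑ + θ + 0) : ℝ × ℝ)) hf fun ϑ => mem_prod.2 ⟨hρ, mem_univ _⟩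
  have h3 : Continuous fun ϑ : ℝ => levelPoint μ K ρ (ϑ + θ + 0) := h2.congr fun _ => rfl
  have h4 : Continuous fun ϑ : ℝ => levelPoint μ K 0 (θ + 0) + levelPoint μ K ρ (ϑ + θ + 0) := continuous_const.add h3
  exact h4.congr fun ϑ => by unfold pairSumPath; rfl

/-- **THE SIGNED BOX INTEGRAL IS CONTINUOUS IN `ϑ`**: `0 ≤ hi < r`, `|ρ| < r`; `X` jointly continuous on `[−hi,hi] × ℝ`, `∂ᵤK` jointly continuous, `w` continuous on
`[−hi,hi]` ⟹ `ϑ ↦ ∫_{−hi..hi}∫_{φa..φb} w(e)·(X(e,v)·(K e)′(e_K(S(ϑ) − Φ(e,v+θ)))) dv de` is continuous. -/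
theorem continuous_boxIntegral {ρ : ℝ} (hρ : |ρ| < r) (θ : ℝ) {φa φb hi : ℝ} (hhi0 : 0 ≤ hi) (hhir : hi < r) {Kr X : ℝ → ℝ → ℝ} {wt : ℝ → ℝ}
    (hX2 : ContinuousOn (fun p : ℝ × ℝ => X p.1 p.2) (Icc (-hi) hi ×ˢ univ)) (hKc : Continuous fun p : ℝ × ℝ => deriv (Kr p.1) p.2)
    (hwc : ContinuousOn wt (Icc (-hi) hi)) :
    Continuous fun ϑ : ℝ => ∫ e in (-hi)..hi, ∫ v in φa..φb,
      wt e * (X e v * deriv (Kr e) (frameLevel μ K (pairSumPath μ K ρ ϑ θ 0 - levelPoint μ K e (v + θ)))) := by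
  set B := bandBounds (show (-4 : ℝ) < -1.1 by norm_num) (show (-1.1 : ℝ) ≤ -0.1 by norm_num) (show (-0.1 : ℝ) < 0 by norm_num) with hBdef
  have hADt : 2 * A < B.Dtmin := by have := klCurveD_pos; linarith only [this, hd]
  have hlev : ContinuousOn (fun p : ℝ × ℝ => levelPoint μ K p.1 p.2) ({x : ℝ | |x| < r} ×ˢ univ) :=
    (contDiffOn_levelPoint B hA hADt hlo hhi (m := 0)).continuousOn
  have hfl : Continuous (frameLevel μ K) := (EngineV8.contDiff_frameLevel μ K (n := 0)).continuous
  have hS : Continuous fun ϑ : ℝ => pairSumPath μ K ρ ϑ θ 0 := continuous_pairSumPath_angle hA hd hlo hhi hρ θ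
  have hhh : -hi ≤ hi := by linarith only [hhi0]
  -- the clamp of the loop level, as a function of `q = (ϑ, (e, v))`
  have hcl : Continuous fun q : ℝ × (ℝ × ℝ) => max (-hi) (min q.2.1 hi) :=
    continuous_const.max ((continuous_fst.comp continuous_snd).min continuous_const)
  have hclI : ∀ q : ℝ × (ℝ × ℝ), max (-hi) (min q.2.1 hi) ∈ Icc (-hi) hi := fun q => ⟨le_max_left _ _, max_le hhh (min_le_right _ _)⟩
  have hclr : ∀ q : ℝ × (ℝ × ℝ), |max (-hi) (min q.2.1 hi)| < r := fun q =>
    abs_lt.2 ⟨by linarith only [(hclI q).1, hhir], lt_of_le_of_lt (hclI q).2 hhir⟩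
  -- the factors, composed without expected types
  have hw := hwc.comp_continuous (f := fun q : ℝ × (ℝ × ℝ) => max (-hi) (min q.2.1 hi)) hcl fun q => hclI q
  have hXc := hX2.comp_continuous (f := fun q : ℝ × (ℝ × ℝ) => ((max (-hi) (min q.2.1 hi), q.2.2) : ℝ × ℝ))
    (hcl.prodMk (continuous_snd.comp continuous_snd)) fun q => mem_prod.2 ⟨hclI q, mem_univ _⟩
  have hL := hlev.comp_continuous (f := fun q : ℝ × (ℝ × ℝ) => ((max (-hi) (min q.2.1 hi), q.2.2 + θ) : ℝ × ℝ))
    (hcl.prodMk ((continuous_snd.comp continuous_snd).add continuous_const)) fun q => mem_prod.2 ⟨hclr q, mem_univ _⟩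
  have hL' : Continuous fun q : ℝ × (ℝ × ℝ) => levelPoint μ K (max (-hi) (min q.2.1 hi)) (q.2.2 + θ) := hL.congr fun _ => rfl
  have hSq : Continuous fun q : ℝ × (ℝ × ℝ) => pairSumPath μ K ρ q.1 θ 0 := hS.comp continuous_fst
  have hband := hfl.comp (hSq.sub hL')
  have hband' : Continuous fun q : ℝ × (ℝ × ℝ) => frameLevel μ K (pairSumPath μ K ρ q.1 θ 0 - levelPoint μ K (max (-hi) (min q.2.1 hi)) (q.2.2 + θ)) :=
    hband.congr fun _ => rfl
  have hK := hKc.comp (hcl.prodMk hband')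
  have hK' : Continuous fun q : ℝ × (ℝ × ℝ) =>
      deriv (Kr (max (-hi) (min q.2.1 hi))) (frameLevel μ K (pairSumPath μ K ρ q.1 θ 0 - levelPoint μ K (max (-hi) (min q.2.1 hi)) (q.2.2 + θ))) :=
    hK.congr fun _ => rfl
  have hw' : Continuous fun q : ℝ × (ℝ × ℝ) => wt (max (-hi) (min q.2.1 hi)) := hw.congr fun _ => rfl
  have hXc' : Continuous fun q : ℝ × (ℝ × ℝ) => X (max (-hi) (min q.2.1 hi)) q.2.2 := hXc.congr fun _ => rfl
  have hG : Continuous fun q : ℝ × (ℝ × ℝ) => wt (max (-hi) (min q.2.1 hi)) * (X (max (-hi) (min q.2.1 hi)) q.2.2 *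
      deriv (Kr (max (-hi) (min q.2.1 hi))) (frameLevel μ K (pairSumPath μ K ρ q.1 θ 0 - levelPoint μ K (max (-hi) (min q.2.1 hi)) (q.2.2 + θ)))) :=
    hw'.mul (hXc'.mul hK')
  have hint := continuous_clampedBoxIntegral hG (-hi) hi φa φb
  -- remove the clamp on the integration range
  refine hint.congr fun ϑ => ?_
  exact intervalIntegral_comp_clamp (f := fun e => ∫ v in φa..φb,
    wt e * (X e v * deriv (Kr e) (frameLevel μ K (pairSumPath μ K ρ ϑ θ 0 - levelPoint μ K e (v + θ))))) hhh

/-- **`F(ϑ) = |box integral|` IS CONTINUOUS IN `ϑ`.** -/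
theorem continuous_boxAbsIntegral {ρ : ℝ} (hρ : |ρ| < r) (θ : ℝ) {φa φb hi : ℝ} (hhi0 : 0 ≤ hi) (hhir : hi < r) {Kr X : ℝ → ℝ → ℝ} {wt : ℝ → ℝ}
    (hX2 : ContinuousOn (fun p : ℝ × ℝ => X p.1 p.2) (Icc (-hi) hi ×ˢ univ)) (hKc : Continuous fun p : ℝ × ℝ => deriv (Kr p.1) p.2)
    (hwc : ContinuousOn wt (Icc (-hi) hi)) :
    Continuous fun ϑ : ℝ => |∫ e in (-hi)..hi, ∫ v in φa..φb,
      wt e * (X e v * deriv (Kr e) (frameLevel μ K (pairSumPath μ K ρ ϑ θ 0 - levelPoint μ K e (v + θ))))| :=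
  continuous_abs.comp (continuous_boxIntegral hA hd hlo hhi hρ θ hhi0 hhir hX2 hKc hwc)

/-- **`F(ϑ) = |box integral|` IS INTERVAL-INTEGRABLE** on every `ϑ`-interval `[a, b]`. -/
theorem boxAbsIntegral_intervalIntegrable {ρ : ℝ} (hρ : |ρ| < r) (θ : ℝ) {φa φb hi : ℝ} (hhi0 : 0 ≤ hi) (hhir : hi < r) {Kr X : ℝ → ℝ → ℝ}
    {wt : ℝ → ℝ} (hX2 : ContinuousOn (fun p : ℝ × ℝ => X p.1 p.2) (Icc (-hi) hi ×ˢ univ)) (hKc : Continuous fun p : ℝ × ℝ => deriv (Kr p.1) p.2)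
    (hwc : ContinuousOn wt (Icc (-hi) hi)) (a b : ℝ) :
    IntervalIntegrable (fun ϑ : ℝ => |∫ e in (-hi)..hi, ∫ v in φa..φb,
      wt e * (X e v * deriv (Kr e) (frameLevel μ K (pairSumPath μ K ρ ϑ θ 0 - levelPoint μ K e (v + θ))))|) volume a b :=
  (continuous_boxAbsIntegral hA hd hlo hhi hρ θ hhi0 hhir hX2 hKc hwc).intervalIntegrable a b

/-- **THE TILING SUM FOR THE BOX INTEGRAL, NO INTEGRABILITY ROW**: `0 ≤ ω`; on each tile `[a + kω, a + (k+1)ω]`, `k < N`, `∫ F ≤ b` ⟹ `∫_a^{a+Nω} F ≤ N·b`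
(`…C4aCausticWindowTiling.intervalIntegral_le_card_mul_of_tiling_of_integrable` with `boxAbsIntegral_intervalIntegrable`). -/
theorem boxAbsIntegral_le_card_mul_of_tiling {ρ : ℝ} (hρ : |ρ| < r) (θ : ℝ) {φa φb hi : ℝ} (hhi0 : 0 ≤ hi) (hhir : hi < r) {Kr X : ℝ → ℝ → ℝ}
    {wt : ℝ → ℝ} (hX2 : ContinuousOn (fun p : ℝ × ℝ => X p.1 p.2) (Icc (-hi) hi ×ˢ univ)) (hKc : Continuous fun p : ℝ × ℝ => deriv (Kr p.1) p.2)
    (hwc : ContinuousOn wt (Icc (-hi) hi)) {a ω b : ℝ} {N : ℕ} (hω : 0 ≤ ω)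
    (hb : ∀ k : ℕ, k < N → ∫ ϑ in (a + k * ω)..(a + (k + 1 : ℕ) * ω), |∫ e in (-hi)..hi, ∫ v in φa..φb,
      wt e * (X e v * deriv (Kr e) (frameLevel μ K (pairSumPath μ K ρ ϑ θ 0 - levelPoint μ K e (v + θ))))| ≤ b) :
    ∫ ϑ in a..(a + N * ω), |∫ e in (-hi)..hi, ∫ v in φa..φb,
      wt e * (X e v * deriv (Kr e) (frameLevel μ K (pairSumPath μ K ρ ϑ θ 0 - levelPoint μ K e (v + θ))))| ≤ N * b :=
  intervalIntegral_le_card_mul_of_tiling_of_integrable hω (boxAbsIntegral_intervalIntegrable hA hd hlo hhi hρ θ hhi0 hhir hX2 hKc hwc _ _) hb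

end Sizes

end Summit.HubbardSuperconductivity.HubbardSuperconductivity.Theorems.C4a

end
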